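import Summits.NavierStokesRegularity.NavierStokesRegularity.Theorems.ForcedSymmetry.Negative.WithoutOseen

/-!
# Crux `ForcedSymmetry` (stmt-NavierStokesRegularity-4052), negative side: refutation criterion and the time-shift generator

Negative-side (cdisprove, D-0016) support lemmas extracted from `Cruxes/ForcedSymmetry/Disproof.lean` v6
(§6–§7), companion of `Negative/Witness.lean` and `Negative/WithoutOseen.lean`:

* `TrivialStabiliser`, `not_hasSimSymmetry_iff`, `not_forcedSymmetry_iff` — the refutation criterion:
  `¬ ForcedSymmetry ↔ ∃ C u, InClassA C u ∧ TrivialStabiliser u`; `not_forcedSymmetry_witness` — any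
  counterexample is NONZERO, has Type-I constant `C > ε` (the perturbative regime is empty) and refutes
  the route target `X` (`not_typeIAncientLiouville_of_not_forcedSymmetry`);
* `simGen8`, `HasSimSymmetry8`, `hasSimSymmetry8_of_hasSimSymmetry`, `vanishes_of_steady` — the full
  point-symmetry algebra of the ancient Type-I class has an 8th generator, the time shift `θ∂_t`; the
  typed conclusion (`θ = 0`, blow-up time pinned at `0`) is formally stronger than the card's informal
  one (modelling remark for the planner, immaterial modulo `SymmetricLiouville`), and the pure time shift
  stabilises only the zero field (mean value theorem in `t` + Type-I decay).

No statement of the route is changed; nothing here closes the item (`--supports`).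
-/

noncomputable section

namespace Summit.NavierStokesRegularity.NavierStokesRegularity.Theorems.ForcedSymmetry.Negative

open MeasureTheory Set Filter Topology
open Literature.Analysis.FluidPDE Literature.Analysis.UnboundedOperators
open Summit.NavierStokesRegularity.NavierStokesRegularity.Theses.SymmetryModuliCount
open Summit.NavierStokesRegularity.NavierStokesRegularity.Theorems.MustSqueeze.Negative

/-! ## Refutation criterion: what a disproof must produce -/

/-- Trivial stabiliser in `sim(3)`: no nonzero `ξ` annihilates `u`. -/
def TrivialStabiliser (u : ℝ → EuclideanSpace ℝ (Fin 3) → EuclideanSpace ℝ (Fin 3)) : Prop :=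
  ∀ (a : EuclideanSpace ℝ (Fin 3)) (σ : ℝ) (A : EuclideanSpace ℝ (Fin 3) →L[ℝ] EuclideanSpace ℝ (Fin 3)),
    (∀ x, inner ℝ (A x) x = 0) → (∀ t < 0, ∀ x, simGen u a σ A t x = 0) → a = 0 ∧ σ = 0 ∧ A = 0

/-- `¬ HasSimSymmetry u ↔ TrivialStabiliser u`. -/
theorem not_hasSimSymmetry_iff (u : ℝ → EuclideanSpace ℝ (Fin 3) → EuclideanSpace ℝ (Fin 3)) :
    ¬ HasSimSymmetry u ↔ TrivialStabiliser u := by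
  constructor
  · intro h a σ A hA hL
    by_contra hne
    exact h ⟨a, σ, A, hA, hne, hL⟩
  · rintro h ⟨a, σ, A, hA, hne, hL⟩
    exact hne (h a σ A hA hL)

/-- **Refutation criterion.** `¬ ForcedSymmetry` iff some member of some `A_C` has trivial stabiliser
(the witness `w` of §3 has trivial stabiliser but is not KNSS-mild). -/
theorem not_forcedSymmetry_iff :
    ¬ ForcedSymmetry ↔ ∃ (C : ℝ) (u : ℝ → EuclideanSpace ℝ (Fin 3) → EuclideanSpace ℝ (Fin 3)),
      InClassA C u ∧ TrivialStabiliser u := by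
  constructor
  · intro h
    by_contra hc
    push Not at hc
    exact h fun C u hu => by
      by_contra hns
      exact hc C u hu ((not_hasSimSymmetry_iff u).1 hns)
  · rintro ⟨C, u, hu, hts⟩ hFS
    exact (not_hasSimSymmetry_iff u).2 hts (hFS C u hu)

/-- **Any counterexample is a NONZERO Type-I KNSS-mild ancient field with LARGE constant** `C > ε`
(§5) and trivial stabiliser — i.e. at least a solution of the open Type-I Liouville problem `¬X`, and
moreover one outside every symmetric sub-case. -/
theorem not_forcedSymmetry_witness (h : ¬ ForcedSymmetry) :
    ∃ ε : ℝ, 0 < ε ∧ ∃ (C : ℝ) (u : ℝ → EuclideanSpace ℝ (Fin 3) → EuclideanSpace ℝ (Fin 3)),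
      ε < C ∧ InClassA C u ∧ TrivialStabiliser u ∧ ∃ t < 0, ∃ x, u t x ≠ 0 := by
  obtain ⟨ε, hε, hsmall⟩ := exists_eps_inClassA_vanishes
  obtain ⟨C, u, hu, hts⟩ := not_forcedSymmetry_iff.1 h
  have hnz : ∃ t < 0, ∃ x, u t x ≠ 0 := by
    by_contra hz
    push Not at hz
    exact (not_hasSimSymmetry_iff u).2 hts (hasSimSymmetry_of_vanishes hz)
  refine ⟨ε, hε, C, u, ?_, hu, hts, hnz⟩
  by_contra hle
  push Not at hle
  obtain ⟨t, ht, x, hx⟩ := hnz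
  exact hx (hsmall C u hle hu t ht x)

/-- `¬ ForcedSymmetry ⇒ ¬ X`: a counterexample to the crux is in particular a nontrivial Type-I KNSS-mild
ancient solution (the open Type-I Liouville problem). -/
theorem not_typeIAncientLiouville_of_not_forcedSymmetry (h : ¬ ForcedSymmetry) : ¬ TypeIAncientLiouville :=
  fun hX => h fun C u hu => hasSimSymmetry_of_vanishes (hX C u hu)


/-! ## Modelling remark (planner): the 8th generator — time shift -/

/-- The generator of the FULL point-symmetry algebra of the ancient Type-I class: `sim(3)` plus the time
shift `θ ∂_t` (backward shifts `t ↦ t − θ`, `θ ≥ 0`, map `A_C` into itself with the same `C`).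
`simGen8 u a σ A θ = L_ξ u + θ ∂_t u`; for `σ ≠ 0` it is the spiral scaling centred at the time
`t₀ = −θ/(2σ)` instead of `0`. -/
def simGen8 (u : ℝ → EuclideanSpace ℝ (Fin 3) → EuclideanSpace ℝ (Fin 3)) (a : EuclideanSpace ℝ (Fin 3)) (σ : ℝ)
    (A : EuclideanSpace ℝ (Fin 3) →L[ℝ] EuclideanSpace ℝ (Fin 3)) (θ : ℝ) (t : ℝ) (x : EuclideanSpace ℝ (Fin 3)) :
    EuclideanSpace ℝ (Fin 3) :=
  simGen u a σ A t x + θ • timeDeriv u t x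

/-- Symmetry under a one-parameter subgroup of the 8-dimensional group (the card's informal "u is
invariant under a one-parameter group of translations∘rotations∘scalings", blow-up time NOT pinned). -/
def HasSimSymmetry8 (u : ℝ → EuclideanSpace ℝ (Fin 3) → EuclideanSpace ℝ (Fin 3)) : Prop :=
  ∃ (a : EuclideanSpace ℝ (Fin 3)) (σ : ℝ) (A : EuclideanSpace ℝ (Fin 3) →L[ℝ] EuclideanSpace ℝ (Fin 3)) (θ : ℝ),
    (∀ x, inner ℝ (A x) x = 0) ∧ ¬ (a = 0 ∧ σ = 0 ∧ A = 0 ∧ θ = 0) ∧ ∀ t < 0, ∀ x, simGen8 u a σ A θ t x = 0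

/-- The typed conclusion (`θ = 0`: scalings centred at the space-time origin) is formally STRONGER than
the 8-dimensional one.  REMARK for the planner: a member of `A_C` symmetric ONLY under a spiral scaling
centred at a FUTURE time `t₀ > 0` (`σ ≠ 0`, `θ = −2σt₀`) would satisfy `HasSimSymmetry8` but not
`HasSimSymmetry`, i.e. it falsifies the typed `ForcedSymmetry` while being "symmetric" in the card's
informal sense.  Modulo `SymmetricLiouville` this is immaterial (its self-similar extension to `(−∞, t₀)`
shifted by `t₀` is a nonzero member of `A_C`, same `C`, with a CENTRED symmetry), so `X ⇔ FS ∧ SL` is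
unaffected; interior centres `t₀ < 0` are trivial (boundedness of `u` near the centre forces `u ≡ 0` on
`t < t₀` by letting the scale `λ → 0`, and uniqueness of bounded mild solutions from zero data gives
`t > t₀`), and the pure
time shift (`σ = 0, a = 0, A = 0, θ ≠ 0`) is never a symmetry of a nonzero member
(`vanishes_of_steady`).  The weakest faithful typing of the crux would use `simGen8`. -/
theorem hasSimSymmetry8_of_hasSimSymmetry {u : ℝ → EuclideanSpace ℝ (Fin 3) → EuclideanSpace ℝ (Fin 3)}
    (h : HasSimSymmetry u) : HasSimSymmetry8 u := by
  obtain ⟨a, σ, A, hA, hne, hL⟩ := h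
  refine ⟨a, σ, A, 0, hA, fun h0 => hne ⟨h0.1, h0.2.1, h0.2.2.1⟩, fun t ht x => ?_⟩
  simp [simGen8, hL t ht x]

/-- **Steady Type-I fields vanish**: a member of the class invariant under the pure time shift
(`∂_t u ≡ 0` on `t < 0`) is `0` — `u(t,x) = u(s,x)` for all `s < 0` (mean value theorem on the
time line, differentiability from H1) and `‖u(s,x)‖ ≤ C/√(−s) → 0` as `s → −∞` (H4).  So the 8th
generator alone never stabilises a nonzero member; H2, H3 unused. -/
theorem vanishes_of_steady {C : ℝ} {u : ℝ → EuclideanSpace ℝ (Fin 3) → EuclideanSpace ℝ (Fin 3)}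
    (h1 : H1 u) (h4 : H4 C u) (hst : ∀ t < 0, ∀ x, timeDeriv u t x = 0) : ∀ t < 0, ∀ x, u t x = 0 := by
  intro t ht x
  have hd : DifferentiableOn ℝ (fun s : ℝ => u s x) (Iio 0) := by
    have h1' : DifferentiableOn ℝ (Function.uncurry u) (Iio 0 ×ˢ univ) := h1.differentiableOn (by simp)
    have hp : DifferentiableOn ℝ (fun s : ℝ => (s, x)) (Iio 0) :=
      differentiableOn_id.prodMk (differentiableOn_const x)
    exact h1'.comp hp fun s hs => ⟨hs, mem_univ _⟩
  have hconst : ∀ s < 0, u s x = u t x := fun s hs =>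
    isOpen_Iio.is_const_of_deriv_eq_zero isPreconnected_Iio hd (fun r hr => hst r hr x) hs ht
  rcases le_or_gt C 0 with hC | hC
  · exact vanishes_of_h4_nonpos hC h4 t ht x
  by_contra hne
  have hpos : 0 < ‖u t x‖ := norm_pos_iff.2 hne
  set s : ℝ := -((C / ‖u t x‖) ^ 2 + 1) with hs
  have hs0 : s < 0 := by have := sq_nonneg (C / ‖u t x‖); rw [hs]; linarith
  have hb := h4 s hs0 x
  rw [hconst s hs0] at hb
  have hneg : -s = (C / ‖u t x‖) ^ 2 + 1 := by rw [hs, neg_neg]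
  have hsq : C / ‖u t x‖ < Real.sqrt (-s) := by
    rw [hneg]
    calc C / ‖u t x‖ = Real.sqrt ((C / ‖u t x‖) ^ 2) := (Real.sqrt_sq (by positivity)).symm
      _ < Real.sqrt ((C / ‖u t x‖) ^ 2 + 1) := Real.sqrt_lt_sqrt (sq_nonneg _) (by linarith)
  have hspos : 0 < Real.sqrt (-s) := Real.sqrt_pos.2 (by linarith)
  have hlt : C / Real.sqrt (-s) < ‖u t x‖ := by
    rw [div_lt_iff₀ hspos]
    rw [div_lt_iff₀ hpos] at hsq
    linarith [mul_comm (Real.sqrt (-s)) ‖u t x‖]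
  linarith


end Summit.NavierStokesRegularity.NavierStokesRegularity.Theorems.ForcedSymmetry.Negative
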